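import Mathlib
import Summits.Ventures.PercRepro2.HCov
import Summits.Ventures.PercRepro2.RECMReduction
import Summits.Ventures.PercRepro2.A3Reduction
import Summits.Ventures.PercRepro2.CutVertexPaths
import Summits.Ventures.PercRepro2.IsolatedMark
import Summits.Ventures.PercRepro2.CutReduction
import Summits.Ventures.PercRepro2.GcSkelRules
import Summits.Ventures.PercRepro2.GcSkelReduction
import Summits.Ventures.PercRepro2.GcSkelReductionS
import Summits.Ventures.PercRepro2.GcSkelReductionC
import Summits.Ventures.PercRepro2.GcSkelReductionR
import Summits.Ventures.PercRepro2.GcSkelReductionP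
import Summits.Ventures.PercRepro2.GcSkelReductionI

/-!
# The one open shape at a cut vertex of the residual — the shape and the case closers (blind cell
PercRepro2, typer-1 g53)

On the weighted residual `WRed.WReducedI` (GcSkelReductionI.lean) the cut-vertex clauses say: a
mark-free side carries no non-loop edge (`prune`), a single far mark has at most one non-loop edge
on its side (`oneFar`), the marks are never split `2 + 3` (`twoThree`); with the degree clauses and
`noMarkBehindCut_of_wredI` this leaves ONE shape for a cut vertex with a non-loop edge on each
side — **`A3PendantCut`**: `a₃` alone on one side, its single non-loop edge `{a₃, v}` the only
non-loop edge of that side, the cut vertex `v` unmarked, the other four marks on the other side —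
S3.10's (G1), the cut-vertex form of (LEAF-½).

This file: the shape, the positions of the marks (each on the left, at the cut vertex, or on the
right), and one closer per way a placement of the five marks is excluded or is the shape —
`prune_left` / `prune_right`, the four `oneLeft_*` / `oneRight_*` (via `noMarkBehindCut_of_wredI`),
and `shape_left` / `shape_right`; the ten `twoThree_*` closers and their mirrors are
`GcSkelCutShapeSplits.lean`, the case analysis itself `GcSkelCutShapeMain.lean`.
-/

namespace Summit.Ventures.PercRepro2

open CovForm RECM CutVertexM9

namespace WRed

section Shape

variable {V : Type*} {E : Type*}

/-- **The `a₃`-pendant shape at a cut vertex**: `a₃` alone on the left, the cut vertex unmarked, the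
other four marks on the right, and one edge `{a₃, v}` is the only non-loop left edge. -/
structure A3PendantCut (ends : E → Sym2 V) (side : E → Bool) (L : Set V) (v : V) (Rt : Set V)
    (o a₁ a₂ a₃ b : V) : Prop where
  /-- `a₃` is on the left -/
  a3_left : a₃ ∈ L
  /-- the cut vertex is unmarked -/
  unmarked_v : Unmarked o a₁ a₂ a₃ b v
  /-- `o` is on the right -/
  o_right : o ∈ Rt
  /-- `a₁` is on the right -/
  a1_right : a₁ ∈ Rt
  /-- `a₂` is on the right -/
  a2_right : a₂ ∈ Rt
  /-- `b` is on the right -/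
  b_right : b ∈ Rt
  /-- the edge `{a₃, v}` is the only non-loop left edge -/
  edge : ∃ e, ends e = s(a₃, v) ∧ ∀ g, side g = true → ¬ (ends g).IsDiag → g = e

end Shape

section Positions

variable {V : Type*} {E : Type*}

/-- A vertex on an edge is on the left, the cut vertex, or on the right — packaged with the two
one-sided facts each position gives. -/
lemma pos_of_mem_edge {ends : E → Sym2 V} {side : E → Bool} {L : Set V} {v : V} {Rt : Set V}
    (hcut : CutVertex ends side L v Rt) {x : V} {g : E} (hx : x ∈ ends g) :
    (x ∈ L ∧ (x ∈ L ∨ x = v)) ∨ (x = v ∧ (x ∈ L ∨ x = v) ∧ (x ∈ Rt ∨ x = v)) ∨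
      (x ∈ Rt ∧ (x ∈ Rt ∨ x = v)) := by
  cases hs : side g with
  | true =>
    rcases hcut.left g hs x hx with h | h
    · exact Or.inl ⟨h, Or.inl h⟩
    · exact Or.inr (Or.inl ⟨h, Or.inr h, Or.inr h⟩)
  | false =>
    rcases hcut.right g hs x hx with h | h
    · exact Or.inr (Or.inr ⟨h, Or.inl h⟩)
    · exact Or.inr (Or.inl ⟨h, Or.inr h, Or.inr h⟩)

/-- A vertex that is not isolated is on the left, the cut vertex, or on the right. -/
lemma pos_of_not_isolated {ends : E → Sym2 V} {side : E → Bool} {L : Set V} {v : V} {Rt : Set V}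
    (hcut : CutVertex ends side L v Rt) {x : V} (hx : ¬ IsolatedMark.IsIsolated ends x) :
    (x ∈ L ∧ (x ∈ L ∨ x = v)) ∨ (x = v ∧ (x ∈ L ∨ x = v) ∧ (x ∈ Rt ∨ x = v)) ∨
      (x ∈ Rt ∧ (x ∈ Rt ∨ x = v)) := by
  unfold IsolatedMark.IsIsolated at hx
  push Not at hx
  obtain ⟨e, hxe, -⟩ := hx
  exact pos_of_mem_edge hcut hxe

/-- Outside class `R₃`, `a₃` has a non-loop edge to an unmarked vertex. -/
lemma exists_a3_edge_of_not_a3ToMarks {ends : E → Sym2 V} {o a₁ a₂ a₃ b : V}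
    (h3 : ¬ A3RECM.A3ToMarks ends o a₁ a₂ a₃ b) :
    ∃ (e : E) (z : V), ends e = s(a₃, z) ∧ Unmarked o a₁ a₂ a₃ b z := by
  unfold A3RECM.A3ToMarks at h3
  push Not at h3
  obtain ⟨e, he, z, hz, hzo, hz1, hz2, hz3, hzb⟩ := h3
  refine ⟨e, z, ?_, hzo, hz1, hz2, hz3, hzb⟩
  exact ((Sym2.mem_and_mem_iff (Ne.symm hz3)).1 ⟨he, hz⟩)

/-- Outside class `R₃`, `a₃` is on the left, the cut vertex, or on the right. -/
lemma pos_a3_of_not_a3ToMarks {ends : E → Sym2 V} {side : E → Bool} {L : Set V} {v : V}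
    {Rt : Set V} (hcut : CutVertex ends side L v Rt) {o a₁ a₂ a₃ b : V}
    (h3 : ¬ A3RECM.A3ToMarks ends o a₁ a₂ a₃ b) :
    (a₃ ∈ L ∧ (a₃ ∈ L ∨ a₃ = v)) ∨ (a₃ = v ∧ (a₃ ∈ L ∨ a₃ = v) ∧ (a₃ ∈ Rt ∨ a₃ = v)) ∨
      (a₃ ∈ Rt ∧ (a₃ ∈ Rt ∨ a₃ = v)) := by
  obtain ⟨e, z, he, -⟩ := exists_a3_edge_of_not_a3ToMarks h3
  exact pos_of_mem_edge hcut (by rw [he]; exact Sym2.mem_mk_left _ _)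

/-- A statement on each of the five marks is a statement on the set of marks. -/
lemma forall_marks {o a₁ a₂ a₃ b : V} {P : V → Prop} (ho : P o) (h1 : P a₁) (h2 : P a₂) (h3 : P a₃)
    (hb : P b) : ∀ m ∈ ({o, a₁, a₂, a₃, b} : Set V), P m := by
  intro m hm
  simp only [Set.mem_insert_iff, Set.mem_singleton_iff] at hm
  rcases hm with rfl | rfl | rfl | rfl | rfl <;> assumption

/-- A statement on each of `o, a₁, a₂, b` is a statement on that set of marks. -/
lemma forall_marks4 {o a₁ a₂ b : V} {P : V → Prop} (ho : P o) (h1 : P a₁) (h2 : P a₂) (hb : P b) :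
    ∀ m ∈ ({o, a₁, a₂, b} : Set V), P m := by
  intro m hm
  simp only [Set.mem_insert_iff, Set.mem_singleton_iff] at hm
  rcases hm with rfl | rfl | rfl | rfl <;> assumption

end Positions

section Closers

variable {V : Type*} {E : Type*} [Fintype E] [DecidableEq V]
variable {ends : E → Sym2 V} {side : E → Bool} {L : Set V} {v : V} {Rt : Set V} {o a₁ a₂ a₃ b : V}

/-- A mark-free left side carries no non-loop edge (`prune`). -/
lemma prune_left (h : WReducedI ends o a₁ a₂ a₃ b) (hcut : CutVertex ends side L v Rt)
    (ho : o ∈ Rt ∨ o = v) (h1 : a₁ ∈ Rt ∨ a₁ = v) (h2 : a₂ ∈ Rt ∨ a₂ = v) (h3 : a₃ ∈ Rt ∨ a₃ = v)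
    (hb : b ∈ Rt ∨ b = v) (hL : ∃ g, side g = true ∧ ¬ (ends g).IsDiag) : False := by
  obtain ⟨g, hg, hd⟩ := hL
  exact hd (h.prune side L v Rt g hcut (forall_marks ho h1 h2 h3 hb) hg)

/-- A mark-free right side carries no non-loop edge (`prune` on the mirror). -/
lemma prune_right (h : WReducedI ends o a₁ a₂ a₃ b) (hcut : CutVertex ends side L v Rt)
    (ho : o ∈ L ∨ o = v) (h1 : a₁ ∈ L ∨ a₁ = v) (h2 : a₂ ∈ L ∨ a₂ = v) (h3 : a₃ ∈ L ∨ a₃ = v)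
    (hb : b ∈ L ∨ b = v) (hR : ∃ g, side g = false ∧ ¬ (ends g).IsDiag) : False := by
  obtain ⟨g, hg, hd⟩ := hR
  exact hd (h.prune (fun e => !side e) Rt v L g hcut.symm (forall_marks ho h1 h2 h3 hb)
    (by simp [hg]))

/-- No mark among `a₁, a₂, o, b` is alone on the left (`noMarkBehindCut_of_wredI`). -/
lemma not_one_left (h : WReducedI ends o a₁ a₂ a₃ b) (hcut : CutVertex ends side L v Rt) {w : V}
    (hw : w ∈ L) (hwm : w = a₁ ∨ w = a₂ ∨ w = o ∨ w = b)
    (hM : ∀ m ∈ ({o, a₁, a₂, a₃, b} : Set V), m = w ∨ m ∈ Rt ∨ m = v) : False :=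
  noMarkBehindCut_of_wredI h ⟨side, L, Rt, v, w, hcut, hw, hwm, hM⟩

/-- No mark among `a₁, a₂, o, b` is alone on the right. -/
lemma not_one_right (h : WReducedI ends o a₁ a₂ a₃ b) (hcut : CutVertex ends side L v Rt) {w : V}
    (hw : w ∈ Rt) (hwm : w = a₁ ∨ w = a₂ ∨ w = o ∨ w = b)
    (hM : ∀ m ∈ ({o, a₁, a₂, a₃, b} : Set V), m = w ∨ m ∈ L ∨ m = v) : False :=
  noMarkBehindCut_of_wredI h ⟨fun e => !side e, Rt, L, v, w, hcut.symm, hw, hwm, hM⟩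

/-- `o` is not alone on the left. -/
lemma oneLeft_o (h : WReducedI ends o a₁ a₂ a₃ b) (hcut : CutVertex ends side L v Rt)
    (hw : o ∈ L) (ha1 : a₁ ∈ Rt ∨ a₁ = v) (ha2 : a₂ ∈ Rt ∨ a₂ = v) (h3 : a₃ ∈ Rt ∨ a₃ = v)
    (hb : b ∈ Rt ∨ b = v) : False :=
  not_one_left h hcut hw (Or.inr (Or.inr (Or.inl rfl)))
    (forall_marks (Or.inl rfl) (Or.inr ha1) (Or.inr ha2) (Or.inr h3) (Or.inr hb))

/-- `a₁` is not alone on the left. -/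
lemma oneLeft_a1 (h : WReducedI ends o a₁ a₂ a₃ b) (hcut : CutVertex ends side L v Rt)
    (hw : a₁ ∈ L) (ho : o ∈ Rt ∨ o = v) (ha2 : a₂ ∈ Rt ∨ a₂ = v) (h3 : a₃ ∈ Rt ∨ a₃ = v)
    (hb : b ∈ Rt ∨ b = v) : False :=
  not_one_left h hcut hw (Or.inl rfl)
    (forall_marks (Or.inr ho) (Or.inl rfl) (Or.inr ha2) (Or.inr h3) (Or.inr hb))

/-- `a₂` is not alone on the left. -/
lemma oneLeft_a2 (h : WReducedI ends o a₁ a₂ a₃ b) (hcut : CutVertex ends side L v Rt)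
    (hw : a₂ ∈ L) (ho : o ∈ Rt ∨ o = v) (ha1 : a₁ ∈ Rt ∨ a₁ = v) (h3 : a₃ ∈ Rt ∨ a₃ = v)
    (hb : b ∈ Rt ∨ b = v) : False :=
  not_one_left h hcut hw (Or.inr (Or.inl rfl))
    (forall_marks (Or.inr ho) (Or.inr ha1) (Or.inl rfl) (Or.inr h3) (Or.inr hb))

/-- `b` is not alone on the left. -/
lemma oneLeft_b (h : WReducedI ends o a₁ a₂ a₃ b) (hcut : CutVertex ends side L v Rt)
    (hw : b ∈ L) (ho : o ∈ Rt ∨ o = v) (ha1 : a₁ ∈ Rt ∨ a₁ = v) (ha2 : a₂ ∈ Rt ∨ a₂ = v)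
    (h3 : a₃ ∈ Rt ∨ a₃ = v) : False :=
  not_one_left h hcut hw (Or.inr (Or.inr (Or.inr rfl)))
    (forall_marks (Or.inr ho) (Or.inr ha1) (Or.inr ha2) (Or.inr h3) (Or.inl rfl))

/-- `o` is not alone on the right. -/
lemma oneRight_o (h : WReducedI ends o a₁ a₂ a₃ b) (hcut : CutVertex ends side L v Rt)
    (hw : o ∈ Rt) (ha1 : a₁ ∈ L ∨ a₁ = v) (ha2 : a₂ ∈ L ∨ a₂ = v) (h3 : a₃ ∈ L ∨ a₃ = v)
    (hb : b ∈ L ∨ b = v) : False :=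
  not_one_right h hcut hw (Or.inr (Or.inr (Or.inl rfl)))
    (forall_marks (Or.inl rfl) (Or.inr ha1) (Or.inr ha2) (Or.inr h3) (Or.inr hb))

/-- `a₁` is not alone on the right. -/
lemma oneRight_a1 (h : WReducedI ends o a₁ a₂ a₃ b) (hcut : CutVertex ends side L v Rt)
    (hw : a₁ ∈ Rt) (ho : o ∈ L ∨ o = v) (ha2 : a₂ ∈ L ∨ a₂ = v) (h3 : a₃ ∈ L ∨ a₃ = v)
    (hb : b ∈ L ∨ b = v) : False :=
  not_one_right h hcut hw (Or.inl rfl)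
    (forall_marks (Or.inr ho) (Or.inl rfl) (Or.inr ha2) (Or.inr h3) (Or.inr hb))

/-- `a₂` is not alone on the right. -/
lemma oneRight_a2 (h : WReducedI ends o a₁ a₂ a₃ b) (hcut : CutVertex ends side L v Rt)
    (hw : a₂ ∈ Rt) (ho : o ∈ L ∨ o = v) (ha1 : a₁ ∈ L ∨ a₁ = v) (h3 : a₃ ∈ L ∨ a₃ = v)
    (hb : b ∈ L ∨ b = v) : False :=
  not_one_right h hcut hw (Or.inr (Or.inl rfl))
    (forall_marks (Or.inr ho) (Or.inr ha1) (Or.inl rfl) (Or.inr h3) (Or.inr hb))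

/-- `b` is not alone on the right. -/
lemma oneRight_b (h : WReducedI ends o a₁ a₂ a₃ b) (hcut : CutVertex ends side L v Rt)
    (hw : b ∈ Rt) (ho : o ∈ L ∨ o = v) (ha1 : a₁ ∈ L ∨ a₁ = v) (ha2 : a₂ ∈ L ∨ a₂ = v)
    (h3 : a₃ ∈ L ∨ a₃ = v) : False :=
  not_one_right h hcut hw (Or.inr (Or.inr (Or.inr rfl)))
    (forall_marks (Or.inr ho) (Or.inr ha1) (Or.inr ha2) (Or.inr h3) (Or.inl rfl))

/-- The non-loop degree of a left vertex all of whose non-loop edges equal `e` is one. -/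
lemma nonLoopDeg_eq_one_of_unique {x : V} (hx : x ∈ L) (hcut : CutVertex ends side L v Rt) {e : E}
    (hxe : x ∈ ends e) (hed : ¬ (ends e).IsDiag)
    (huniq : ∀ g, side g = true → ¬ (ends g).IsDiag → g = e) : nonLoopDeg ends x = 1 := by
  have hset : edgesAt ends x = {e} := by
    ext g
    rw [mem_edgesAt, Finset.mem_singleton]
    constructor
    · rintro ⟨hg, hgd⟩
      exact huniq g (side_eq_true_of_mem_left hcut hx hg) hgd
    · rintro rfl
      exact ⟨hxe, hed⟩
  unfold nonLoopDeg
  rw [hset, Finset.card_singleton]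

/-- **`a₃` alone on the left is the `a₃`-pendant shape**: by `oneFar` the left side has at most one
non-loop edge; `a₃`'s edge to an unmarked vertex (class `R₃` excluded) is one, so it is the only one;
its other end cannot be an unmarked left vertex (it would have non-loop degree one), so it is the
cut vertex `v`; `a₃` is then a leaf at `v`, and `v` is unmarked by `leaf_a3`. -/
lemma shape_left (h : WReducedI ends o a₁ a₂ a₃ b) (hcut : CutVertex ends side L v Rt)
    (h3 : a₃ ∈ L) (ho : o ∈ Rt ∨ o = v) (h1 : a₁ ∈ Rt ∨ a₁ = v) (h2 : a₂ ∈ Rt ∨ a₂ = v)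
    (hb : b ∈ Rt ∨ b = v) : A3PendantCut ends side L v Rt o a₁ a₂ a₃ b := by
  have hM : ∀ m ∈ ({o, a₁, a₂, a₃, b} : Set V), m = a₃ ∨ m ∈ Rt ∨ m = v :=
    forall_marks (Or.inr ho) (Or.inr h1) (Or.inr h2) (Or.inl rfl) (Or.inr hb)
  have hone : leftCard ends side ≤ 1 := h.oneFar side L v Rt a₃ hcut h3 hM
  obtain ⟨e, z, he, hz⟩ := exists_a3_edge_of_not_a3ToMarks h.notR3
  have hz3 : z ≠ a₃ := hz.2.2.2.1
  have hed : ¬ (ends e).IsDiag := by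
    rw [he, Sym2.mk_isDiag_iff]
    exact fun h' => hz3 h'.symm
  have h3e : a₃ ∈ ends e := by rw [he]; exact Sym2.mem_mk_left _ _
  have hze : z ∈ ends e := by rw [he]; exact Sym2.mem_mk_right _ _
  have hse : side e = true := side_eq_true_of_mem_left hcut h3 h3e
  have huniq : ∀ g, side g = true → ¬ (ends g).IsDiag → g = e := by
    intro g hg hgd
    exact Finset.card_le_one.1 hone g (Finset.mem_filter.2 ⟨Finset.mem_univ _, hg, hgd⟩)
      e (Finset.mem_filter.2 ⟨Finset.mem_univ _, hse, hed⟩)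
  -- the other end of `e` is the cut vertex
  have hzv : z = v := by
    rcases hcut.left e hse z hze with hzL | hzv
    · exfalso
      exact (h.unmarked z hz).1 (nonLoopDeg_eq_one_of_unique hzL hcut hze hed huniq)
    · exact hzv
  subst hzv
  have hd3 : nonLoopDeg ends a₃ = 1 := nonLoopDeg_eq_one_of_unique h3 hcut h3e hed huniq
  have hv : Unmarked o a₁ a₂ a₃ b z := h.leaf_a3 e z (by rw [he, Sym2.eq_swap]) hz3 hd3
  refine ⟨h3, hv, ?_, ?_, ?_, ?_, ⟨e, he, huniq⟩⟩
  · exact ho.resolve_right fun h' => hv.1 h'.symm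
  · exact h1.resolve_right fun h' => hv.2.1 h'.symm
  · exact h2.resolve_right fun h' => hv.2.2.1 h'.symm
  · exact hb.resolve_right fun h' => hv.2.2.2.2 h'.symm

/-- **`a₃` alone on the right is the mirrored `a₃`-pendant shape.** -/
lemma shape_right (h : WReducedI ends o a₁ a₂ a₃ b) (hcut : CutVertex ends side L v Rt)
    (h3 : a₃ ∈ Rt) (ho : o ∈ L ∨ o = v) (h1 : a₁ ∈ L ∨ a₁ = v) (h2 : a₂ ∈ L ∨ a₂ = v)
    (hb : b ∈ L ∨ b = v) : A3PendantCut ends (fun e => !side e) Rt v L o a₁ a₂ a₃ b :=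
  shape_left h hcut.symm h3 ho h1 h2 hb

end Closers

end WRed

end Summit.Ventures.PercRepro2
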